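import Summits.BirchSwinnertonDyer.BirchSwinnertonDyer.Theorems.GenusKolyvaginAtTwoMinimalTwinBSDTwoSwappedPairOneBitDescent
import Summits.BirchSwinnertonDyer.BirchSwinnertonDyer.Theorems.GenusKolyvaginAtTwoGenusPrimitiveSupplyAtTwoPrimeHeegnerTwin
import HarnessLib

/-!
# Route `GenusKolyvaginAtTwo`, crux U₂ `MinimalTwinBSDTwo` (stmt-BirchSwinnertonDyer-22985), the cell `hTw1 = (Δ < 0, ord₂ C = 1)`:
# ON A PRIME HEEGNER FIELD THE ONE-BIT BUDGET IS AUTOMATIC — `ord₂ C(Wd) = ord₂ C(W) + 1` for `d_K = −ℓ`, `Δ_W < 0`, any `C(W)` —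
# so the reversed depth-one supply S2⁻ needs no Tamagawa clause on the prime frame

Seat `bsd-line-gk2-p3` g28 (PROVER seat 3/3, cell `bsd-f1-sign2`), `--supports stmt-BirchSwinnertonDyer-22985` (helper; closes nothing).
THEOREMS ONLY (no definition, no named fact, no `sorry`); standard axioms.  **BSD is NOT proved by this file; U₂ / hTw1 are NOT proved; no item
is closed.**  §1 is UNCONDITIONAL; §2 is CONDITIONAL on its displayed hypotheses (the rank-`0` wall S1, the prime-frame reversed supply S2⁻′,
and the route's four PRINT facts), exactly as `OneBit.hTw1_of_wall_of_reversedSupplyDepthOne_of_facts` (p766822 §3).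

WHY.  The LEAD's design decision for the supply kernels (08:18Z/08:38Z: K-items on the PRIME frame `K = ℚ(√−ℓ₀)`) has an exact mirror on the
reversed side: for a prime Heegner discriminant `d_K = −ℓ` and `Δ_W < 0` the twist costs EXACTLY one bit, whatever `C(W)` is —
gk2-p2 g17's `padicValNat_two_tamagawaProduct_twin_eq_one_of_prime` is the case `C(W)` odd; here the hT-free form via this seat's
`OneBit.prod_ncard_roots_add_one_mul_eq_two_pow_padicValNat_tamagawaProduct_twin` (p766610) and gk2-p5's `GenusKolyTwin.natCard_twoTorsion_padic_eq_two_of_discr_eq_neg_prime`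
(`(Δ_min/ℓ) = sign Δ = −1`: exactly one root of the `2`-division cubic mod `ℓ`).

* §1 **`padicValNat_two_tamagawaProduct_twin_eq_succ_of_discr_eq_neg_prime`** — `W` globally minimal (any `C(W)`), `Δ_W < 0`, `K` with
  `d_K = −ℓ` (`ℓ` prime), `d_K` odd, Heegner for `N_W`, `Wd = Cd • W^(d_K)` any elliptic model: **`ord₂ C(Wd) = ord₂ C(W) + 1`**.  UNCONDITIONAL.
* §2 **`hTw1_of_wall_of_reversedSupplyDepthOnePrime_of_facts`** — the census composition of p766822 §3 on the PRIME frame: **`hTw1 ⟸ S1 + S2⁻′ +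
  PRINT`**, where S2⁻′ is S2⁻ with the Tamagawa clause `ord₂ C(Wd) ≤ 2` REPLACED by «`d_K = −ℓ`, `ℓ` prime» (the budget then holds by §1):
  for `W` non-CM, `r_an = 1`, `#Sel₂ = 2`, `Δ < 0`, `ord₂ C(W) = 1`, some prime Heegner field `K = ℚ(√−ℓ)` (`d_K` odd `≠ −3`), a datum `Dt`
  (`c ≠ 0`), `P(1)` of infinite order with `2^(ord₂ c + 1) ∥ P(1)` in `E(K[1])`, and a globally minimal `2`-Selmer-trivial twin `Wd ≅ E^(d_K)`.
  This is the instrument shape (pen / -data: first admissible PRIME `ℓ` per cell).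

References: [Kramer1981] §2 Prop. 3; [GrossLMS1991] §1, §5 Prop. 5.3; [IrelandRosen1990] Prop. 5.2.2; [GrossZagier1986] V.§2 (2.2);
[Milne1972ArithmeticAV] §1 Thm. 1; [Miller2011LMS] Def. 1.1.
-/

set_option autoImplicit false
set_option linter.dupNamespace false -- `Summit.<P>.<Sub>` repeats `BirchSwinnertonDyer` (D-0017)

noncomputable section

open scoped Classical

open WeierstrassCurve NumberField Literature.NumberTheory.EllipticCurves
  Literature.NumberTheory.EllipticCurves.ModularForms
  Literature.NumberTheory.EllipticCurves.Rank1Residual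
  Literature.NumberTheory.EllipticCurves.Rank1Residual.Typed
  Literature.NumberTheory.EllipticCurves.KrizLi2019
  Summit.BirchSwinnertonDyer.Rank1Residual
  Summit.BirchSwinnertonDyer.Rank1Residual.AdditivePotMult
  Summit.BirchSwinnertonDyer.BirchSwinnertonDyer.Rank1Residual
  Summit.BirchSwinnertonDyer.BirchSwinnertonDyer.Theorems.CMExactDescent
  Summit.BirchSwinnertonDyer.BirchSwinnertonDyer.Theorems.GenusExact.TwinSwap
  Summit.BirchSwinnertonDyer.BirchSwinnertonDyer.Theorems.GenusExact.PlusDescent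

namespace Summit.BirchSwinnertonDyer.BirchSwinnertonDyer.Theorems.GenusExact.TwinSwap.OneBit

/-! ## §1 Prime Heegner discriminant on `Δ < 0`: the twist costs exactly one bit, for any `C(W)` -/

/-- **`ord₂ C(Wd) = ord₂ C(W) + 1` for a prime Heegner discriminant on `Δ_W < 0`** (UNCONDITIONAL, no parity hypothesis on `C(W)`).
`W/ℚ` globally minimal with `Δ_W < 0`; `K` imaginary quadratic with `d_K = −ℓ`, `ℓ` prime, `d_K` odd, Heegner for `N_W`; `Wd = Cd • W^(d_K)` any
elliptic model.  The single prime `ℓ` of `d_K` is a TRANSPOSITION prime (`(Δ_min/ℓ) = sign Δ = −1`: exactly one root of the `2`-division cubic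
mod `ℓ`, gk2-p5's `GenusKolyTwin.natCard_twoTorsion_padic_eq_two_of_discr_eq_neg_prime`), and `(∏_{q∣d_K}(1+#roots_q))·2^{ord₂ C(W)} = 2^{ord₂ C(Wd)}`
(this seat's p766610).  [cite: Kramer1981, §2 Prop. 3] [cite: IrelandRosen1990, Prop. 5.2.2] [cite: GrossLMS1991, §1 (p. 235)] -/
theorem padicValNat_two_tamagawaProduct_twin_eq_succ_of_discr_eq_neg_prime
    (W : WeierstrassCurve ℚ) [W.IsElliptic] [W.IsGloballyMinimal]
    {K : Type} [Field K] [NumberField K] (hK : IsImaginaryQuadratic K) (hodd : Odd (NumberField.discr K))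
    (hH : SatisfiesHeegnerHypothesis (W.conductorNorm ℤ) K) {ℓ : ℕ} (hℓ : ℓ.Prime) (hd : NumberField.discr K = -(ℓ : ℤ))
    (hΔ : W.Δ < 0) {Wd : WeierstrassCurve ℚ} [Wd.IsElliptic] (Cd : VariableChange ℚ)
    (hWd : Cd • W.quadraticTwist (NumberField.discr K : ℚ) = Wd) :
    padicValNat 2 Wd.tamagawaProduct = padicValNat 2 W.tamagawaProduct + 1 := by
  haveI := Fact.mk hℓ
  have h := prod_ncard_roots_add_one_mul_eq_two_pow_padicValNat_tamagawaProduct_twin W hK hodd hH Cd hWd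
  have hnat : (NumberField.discr K).natAbs = ℓ := by rw [hd, Int.natAbs_neg, Int.natAbs_natCast]
  obtain ⟨hℓ2, -, hℓΔ⟩ := GenusKolyTwin.prime_discr_facts W hK hodd hH hℓ hd
  have hone : {x : ZMod ℓ | 4 * x ^ 3 + ((integralModelInt W).b₂ : ZMod ℓ) * x ^ 2 +
      2 * ((integralModelInt W).b₄ : ZMod ℓ) * x + ((integralModelInt W).b₆ : ZMod ℓ) = 0}.ncard + 1 = 2 := by
    rw [← GenusKolyTwin.natCard_twoTorsion_padic_eq W hℓ2 hℓΔ]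
    exact GenusKolyTwin.natCard_twoTorsion_padic_eq_two_of_discr_eq_neg_prime W hK hodd hH hd hΔ
  rw [hnat, Nat.Prime.primeFactors hℓ, Finset.prod_singleton, hone, ← pow_succ'] at h
  exact (Nat.pow_right_injective le_rfl h).symm

/-! ## §2 The cell `hTw1` from the wall, the PRIME-FRAME reversed depth-one supply and PRINT -/

/-- **`hTw1 ⟸ S1 + S2⁻′ + PRINT` on the prime frame** (pure logic over p766822 §1 and §1 above).  With
`hS1` — LINE 23's anchor S1 (`MinimalRankZeroBSDTwo`, pen v1.1 text verbatim), and
`hS2p` — S2⁻′: for `W` non-CM, `r_an = 1`, `#Sel₂ = 2`, `Δ < 0`, `ord₂ C(W) = 1`: some imaginary quadratic `K` with **`d_K = −ℓ`, `ℓ` prime**, `d_K`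
odd `≠ −3`, Heegner for `N_W`, a datum `Dt` with `c ≠ 0`, a conductor-`1` datum with `P(1)` of infinite order and `2^(ord₂ c + 1) ∥ P(1)` in
`E(K[1])`, and a globally minimal `2`-Selmer-TRIVIAL twin `Wd ≅ E^(d_K)` — NO Tamagawa clause (the one-bit budget `ord₂ C(Wd) = 2` is §1);
and the four PRINT items: **every `W` on the cell `hTw1 = (Δ < 0, ord₂ C = 1)` satisfies `BSD₂`**.  The twin's `r_an = 0` and non-CM are derived.
CONDITIONAL on the displayed hypotheses; BSD is NOT proved; nothing is closed.
[cite: GrossZagier1986, V.§2 (2.2)] [cite: Milne1972ArithmeticAV, §1 Thm. 1] [cite: Kramer1981, §2 Prop. 3] [cite: Miller2011LMS, Def. 1.1] -/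
theorem hTw1_of_wall_of_reversedSupplyDepthOnePrime_of_facts
    (hGZ : ∀ (N : ℕ) [NeZero N] (W : WeierstrassCurve ℚ) (K : Type) [Field K] [NumberField K], gross_zagier N W K)
    (hGZK : rank_eq_analyticRank_of_analyticRank_le_one) (hmod : hasEntireLFunction_rat)
    (hMilneC : Milne1972.bsdQuotient_baseChange_quadratic_anyModel)
    (hS1 : ∀ (W : WeierstrassCurve ℚ) [W.IsElliptic] [W.IsGloballyMinimal],
      ¬ W.HasCM → W.analyticRank = 0 → Nat.card (W.selmerGroup 2) = 1 → BSDp W 2)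
    (hS2p : ∀ (W : WeierstrassCurve ℚ) [W.IsElliptic] [W.IsGloballyMinimal] [NeZero (W.conductorNorm ℤ)],
      ¬ W.HasCM → W.analyticRank = 1 → Nat.card (W.selmerGroup 2) = 2 → W.Δ < 0 → padicValNat 2 W.tamagawaProduct = 1 →
      ∃ (K : Type) (_ : Field K) (_ : NumberField K),
        IsImaginaryQuadratic K ∧ (∃ ℓ : ℕ, ℓ.Prime ∧ NumberField.discr K = -(ℓ : ℤ)) ∧ Odd (NumberField.discr K) ∧
        NumberField.discr K ≠ -3 ∧ SatisfiesHeegnerHypothesis (W.conductorNorm ℤ) K ∧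
        ∃ (Dt : ModularParametrizationData W (W.conductorNorm ℤ)) (β : ℤ) (ι : K →+* ℂ) (d₁ : KolyvaginHeegnerData Dt β ι 1),
          Dt.c ≠ 0 ∧ ¬ IsOfFinAddOrder d₁.derivedPoint ∧
          (∃ Q : (W.baseChange (ringClassField K ι 1)).toAffine.Point,
            ((2 ^ (padicValInt 2 Dt.c + 1) : ℕ) : ℤ) • Q = d₁.derivedPoint) ∧
          (¬ ∃ Q : (W.baseChange (ringClassField K ι 1)).toAffine.Point,
            ((2 ^ (padicValInt 2 Dt.c + 1 + 1) : ℕ) : ℤ) • Q = d₁.derivedPoint) ∧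
          ∃ (Wd : WeierstrassCurve ℚ) (_ : Wd.IsElliptic) (_ : Wd.IsGloballyMinimal),
            (∃ C : WeierstrassCurve.VariableChange ℚ, C • W.quadraticTwist (NumberField.discr K : ℚ) = Wd) ∧
            Nat.card (Wd.selmerGroup 2) = 1) :
    ∀ (W : WeierstrassCurve ℚ) [W.IsElliptic] [W.IsGloballyMinimal], ¬ W.HasCM → W.analyticRank = 1 →
      Nat.card (W.selmerGroup 2) = 2 → W.Δ < 0 → padicValNat 2 W.tamagawaProduct = 1 → BSDp W 2 := by
  intro W _ _ hcm hr hSel hΔ hC1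
  haveI : NeZero (W.conductorNorm ℤ) := ⟨(W.conductorNorm_pos_holds).ne'⟩
  obtain ⟨K, iF, iN, hK, ⟨ℓ, hℓ, hd⟩, hodd, h3, hH, Dt, β, ι, d₁, hc0, hy, hdiv, hndiv, Wd, iE, iM, hWd, hSel1⟩ :=
    hS2p W hcm hr hSel hΔ hC1
  haveI hEK : (W.baseChange K).IsElliptic := isElliptic_baseChange' W K
  have hD0 : (NumberField.discr K : ℚ) ≠ 0 := by exact_mod_cast NumberField.discr_ne_zero K
  haveI hEt : (W.quadraticTwist (NumberField.discr K : ℚ)).IsElliptic := W.isElliptic_quadraticTwist hD0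
  obtain ⟨Cd, hCd⟩ := hWd
  -- the one-bit budget is automatic on the prime frame
  have hDEF : padicValNat 2 Wd.tamagawaProduct ≤ padicValNat 2 W.tamagawaProduct + 1 :=
    (padicValNat_two_tamagawaProduct_twin_eq_succ_of_discr_eq_neg_prime W hK hodd hH hℓ hd hΔ Cd hCd).le
  have hdiv' : ∃ Q : (W.baseChange (ringClassField K ι 1)).toAffine.Point,
      ((2 ^ (padicValInt 2 Dt.c + padicValNat 2 W.tamagawaProduct) : ℕ) : ℤ) • Q = d₁.derivedPoint := by rw [hC1]; exact hdiv
  have hndiv' : ¬ ∃ Q : (W.baseChange (ringClassField K ι 1)).toAffine.Point,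
      ((2 ^ (padicValInt 2 Dt.c + padicValNat 2 W.tamagawaProduct + 1) : ℕ) : ℤ) • Q = d₁.derivedPoint := by rw [hC1]; exact hndiv
  -- the twin is non-CM (same `j`) of analytic rank `0`: `BSD₂(Wd)` from S1
  have hcmd : ¬ Wd.HasCM := by
    rw [← hCd, hasCM_iff_of_j_eq (((W.quadraticTwist (NumberField.discr K : ℚ)).variableChange_j Cd).trans (W.j_quadraticTwist hD0))]
    exact hcm
  obtain ⟨hrd, -⟩ := padicValRat_shaAn_and_shaOrder_of_swappedPair_of_le_succ W K (hGZ _ W K) hGZK hmod hr hSel hΔ hK hodd h3 hH Dt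
    hc0 β ι d₁ hy hdiv' hndiv' Wd Cd hCd hSel1 hDEF
  have hBd : BSDp Wd 2 := hS1 Wd hcmd hrd hSel1
  exact swappedPairDescentAtTwo_tamagawaDepth_of_facts hGZ hGZK hmod hMilneC W hr hSel hΔ K hK hodd h3 hH Dt hc0 β ι d₁ hy hdiv' hndiv'
    Wd ⟨Cd, hCd⟩ hSel1 hDEF hBd

end Summit.BirchSwinnertonDyer.BirchSwinnertonDyer.Theorems.GenusExact.TwinSwap.OneBit

end
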